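import Summits.RiemannHypothesis.RiemannHypothesis.Theorems.SoloInformedGroundStateZeroSide
import Literature.NumberTheory.LFunctions.FordZetaZeroRecipSqSum
import HarnessLib

/-!
# From a pointwise decay `‖ĝ(ρ)‖ ≤ W/‖ρ − ½‖` at the zeros to the zero-sum bound `Σ m(ρ)‖ĝ(ρ)‖² ≤ 0.0463·(197/196)·W²`
# and to `Re Q(g) ≤ 0.0466·W²` (RH-FREE)

WEIL column (LADDER-RH, W-P(P2); crux `ThetaCertificateSound`): step (Z2) of cc-s2-3's WEIL-THEORY-R3 §3‴ — the ASSEMBLY that turns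
ONE integration by parts (`Theorems/WeilColumnThetaMellinTransform.norm_weilMellin_le_of_deriv`: `‖T̂(s)‖ ≤ (∫‖T'‖e^{(σ−½)t})/‖s−½‖`)
into the hypothesis `hB` of the tree's zero-side domination `re_weilQuadratic_le_of_zeroSum_le`, with the tree's EXPLICIT constant
`Σ_ρ m(ρ)/‖ρ‖² ≤ 0.0463` (`FordZetaZeroRecipSqSum.sum_zeroOrder_div_norm_sq_le`, Ford 2002 Lemma 3.3, PROVED) and `|Im ρ| > 14`
(`FordL33.fourteen_lt_abs_im`, giving `‖ρ‖² ≤ (197/196)‖ρ − ½‖²`). Pattern of `HandoffVerifiedWeightBound.lean` (prove-1).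
* `normSq_le_of_decay` — termwise `m‖ĝ(ρ)‖² ≤ (197/196)·W²·m/‖ρ‖²`;
* **`finsum_weilZeroIndex_normSq_le_of_decay`** — `∀ T, Σᶠ_{ρ ∈ weilZeroIndex T} m(ρ)‖ĝ(ρ)‖² ≤ 0.0463·(197/196)·W²`;
* **`re_weilQuadratic_le_of_decay`** — for a Weil test `g` with `‖ĝ(ρ)‖ ≤ W/‖ρ−½‖` at every nontrivial zero: `Re Q(g) ≤ 0.0463·(197/196)·W²`.
UPPER bounds on ground energies only; nothing here bears on the truth of RH.
-/

set_option linter.dupNamespace false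

open Finset Literature.NumberTheory.LFunctions

namespace Summit.RiemannHypothesis.RiemannHypothesis.Theorems.WeilColumn.ThetaMellin

/-- Termwise comparison at a nontrivial zero: if `‖ĝ(ρ)‖ ≤ W/‖ρ − ½‖` then `m(ρ)‖ĝ(ρ)‖² ≤ (197/196)·W²·(m(ρ)/‖ρ‖²)`
(`‖ρ‖² ≤ 1 + γ² ≤ (197/196)γ² ≤ (197/196)‖ρ − ½‖²`, using `0 < Re ρ < 1` and `|γ| > 14`). [folklore; constants from Ford2002Millennium L. 3.3 setting] -/
theorem normSq_le_of_decay {g : ℝ → ℂ} {W : ℝ} (ρ : RHWave0.riemannZetaNontrivialZeros)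
    (h : ‖weilMellin g ρ‖ ≤ W / ‖(ρ : ℂ) - 1 / 2‖) :
    (riemannZetaZeroOrder (ρ : ℂ) : ℝ) * ‖weilMellin g ρ‖ ^ 2 ≤
      (197 / 196) * W ^ 2 * ((riemannZetaZeroOrder (ρ : ℂ) : ℝ) / ‖(ρ : ℂ)‖ ^ 2) := by
  have hm : (0 : ℝ) < riemannZetaZeroOrder (ρ : ℂ) := FordL33.order_pos ρ
  have h14 : 14 < |(ρ : ℂ).im| := FordL33.fourteen_lt_abs_im ρ
  have hre0 : 0 < (ρ : ℂ).re := ZetaZeros.riemannZetaNontrivialZeros.re_pos ρ.2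
  have hre1 : (ρ : ℂ).re < 1 := ZetaZeros.riemannZetaNontrivialZeros.re_lt_one ρ.2
  have him2 : 196 < (ρ : ℂ).im ^ 2 := by
    have : (14 : ℝ) ^ 2 < |(ρ : ℂ).im| ^ 2 := by gcongr
    rw [sq_abs] at this; linarith
  have hnorm : ‖(ρ : ℂ)‖ ^ 2 = (ρ : ℂ).re ^ 2 + (ρ : ℂ).im ^ 2 := by
    rw [Complex.sq_norm, Complex.normSq_apply]; ring
  have hnorm' : ‖(ρ : ℂ) - 1 / 2‖ ^ 2 = ((ρ : ℂ).re - 1 / 2) ^ 2 + (ρ : ℂ).im ^ 2 := by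
    rw [Complex.sq_norm, Complex.normSq_apply]; simp; ring
  have hρpos : 0 < ‖(ρ : ℂ)‖ ^ 2 := by rw [hnorm]; nlinarith
  have hρ'pos : 0 < ‖(ρ : ℂ) - 1 / 2‖ ^ 2 := by rw [hnorm']; nlinarith [sq_nonneg ((ρ : ℂ).re - 1 / 2)]
  have hρ'pos1 : 0 < ‖(ρ : ℂ) - 1 / 2‖ := by
    rcases (norm_nonneg ((ρ : ℂ) - 1 / 2)).eq_or_lt with h0 | h0
    · rw [← h0] at hρ'pos; norm_num at hρ'pos
    · exact h0
  -- ‖ρ‖² ≤ (197/196) ‖ρ − ½‖²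
  have hcmp : ‖(ρ : ℂ)‖ ^ 2 ≤ (197 / 196) * ‖(ρ : ℂ) - 1 / 2‖ ^ 2 := by
    rw [hnorm, hnorm']; nlinarith
  -- square the pointwise bound
  have hsq : ‖weilMellin g ρ‖ ^ 2 ≤ W ^ 2 / ‖(ρ : ℂ) - 1 / 2‖ ^ 2 := by
    rw [← div_pow]
    exact pow_le_pow_left₀ (norm_nonneg _) h 2
  have hsq' : ‖weilMellin g ρ‖ ^ 2 ≤ (197 / 196) * W ^ 2 / ‖(ρ : ℂ)‖ ^ 2 := by
    refine hsq.trans ?_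
    rw [div_le_div_iff₀ hρ'pos hρpos]
    nlinarith [sq_nonneg W]
  calc (riemannZetaZeroOrder (ρ : ℂ) : ℝ) * ‖weilMellin g ρ‖ ^ 2
      ≤ (riemannZetaZeroOrder (ρ : ℂ) : ℝ) * ((197 / 196) * W ^ 2 / ‖(ρ : ℂ)‖ ^ 2) :=
        mul_le_mul_of_nonneg_left hsq' hm.le
    _ = (197 / 196) * W ^ 2 * ((riemannZetaZeroOrder (ρ : ℂ) : ℝ) / ‖(ρ : ℂ)‖ ^ 2) := by ring

/-- **ZERO-SUM BOUND FROM POINTWISE DECAY (RH-free, every truncation `T`).** If `‖ĝ(ρ)‖ ≤ W/‖ρ − ½‖` at every nontrivial zero, then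
`Σᶠ_{ρ ∈ weilZeroIndex T} m(ρ)‖ĝ(ρ)‖² ≤ 0.0463·(197/196)·W²`. [cite: Ford2002Millennium, Lemma 3.3 (the constant 0.0463)] -/
theorem finsum_weilZeroIndex_normSq_le_of_decay {g : ℝ → ℂ} {W : ℝ}
    (h : ∀ ρ : ℂ, ρ ∈ RHWave0.riemannZetaNontrivialZeros → ‖weilMellin g ρ‖ ≤ W / ‖ρ - 1 / 2‖) (T : ℝ) :
    ∑ᶠ ρ ∈ weilZeroIndex T, (riemannZetaZeroOrder ρ : ℝ) * ‖weilMellin g ρ‖ ^ 2 ≤ 0.0463 * ((197 / 196) * W ^ 2) := by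
  rw [finsum_weilZeroIndex_eq_sum (fun ρ ↦ (riemannZetaZeroOrder ρ : ℝ) * ‖weilMellin g ρ‖ ^ 2) T]
  have h1 : ∑ ρ ∈ weilZeroFinset T, (riemannZetaZeroOrder (ρ : ℂ) : ℝ) * ‖weilMellin g ρ‖ ^ 2 ≤
      ∑ ρ ∈ weilZeroFinset T, (197 / 196) * W ^ 2 * ((riemannZetaZeroOrder (ρ : ℂ) : ℝ) / ‖(ρ : ℂ)‖ ^ 2) :=
    sum_le_sum fun ρ _ ↦ normSq_le_of_decay ρ (h ρ ρ.2)
  rw [← mul_sum] at h1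
  have h3 := sum_zeroOrder_div_norm_sq_le (weilZeroFinset T)
  have h4 : (197 / 196) * W ^ 2 * ∑ ρ ∈ weilZeroFinset T, (riemannZetaZeroOrder (ρ : ℂ) : ℝ) / ‖(ρ : ℂ)‖ ^ 2 ≤
      (197 / 196) * W ^ 2 * 0.0463 := mul_le_mul_of_nonneg_left h3 (by positivity)
  linarith

/-- **UPPER BOUND ON THE WEIL ENERGY FROM ONE DERIVATIVE'S WORTH OF DECAY (RH-free).** For a Weil test function `g` whose transform
satisfies `‖ĝ(ρ)‖ ≤ W/‖ρ − ½‖` at every nontrivial zero: `Re Q(g) = Re W(g ⋆ g̃) ≤ 0.0463·(197/196)·W²` — the tree's zero-side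
domination `re_weilQuadratic_le_of_zeroSum_le` (explicit formula, PROVED) fed with Ford's constant. For the PART XIX cut witness the
hypothesis holds with `W = 2·sup_σ ∫‖T'‖e^{(σ−½)t}` by (Z1) (`WeilColumnThetaMellin`, p411028) and (Z2-core)
(`WeilColumnThetaMellinTransform`). [cite: Ford2002Millennium, Lemma 3.3 (the constant 0.0463)] -/
theorem re_weilQuadratic_le_of_decay {g : ℝ → ℂ} (hg : IsWeilTest g) {W : ℝ}
    (h : ∀ ρ : ℂ, ρ ∈ RHWave0.riemannZetaNontrivialZeros → ‖weilMellin g ρ‖ ≤ W / ‖ρ - 1 / 2‖) :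
    (weilQuadratic g).re ≤ 0.0463 * ((197 / 196) * W ^ 2) :=
  re_weilQuadratic_le_of_zeroSum_le hg (finsum_weilZeroIndex_normSq_le_of_decay h)

end Summit.RiemannHypothesis.RiemannHypothesis.Theorems.WeilColumn.ThetaMellin
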